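import Mathlib.Analysis.Calculus.MeanValue
import Literature.MathematicalPhysics.QuantumFieldTheory.BalabanImbrieJaffe1984to88.BIJ88PolymerRep5134

/-!
# `BalabanImbrieJaffe1984to88.BIJ88CornerSumLastCube309` — T. Bałaban, J. Imbrie, A. Jaffe, *Effective action and cluster properties of the
abelian Higgs model*, Commun. Math. Phys. **114** (1988) 257–315 [BalabanImbrieJaffe1988], Sect. 5.13 (5.13.1)–(5.13.3) p. 305 [PDF 49] with
Sect. 5.14 (5.14.3) p. 309 [PDF 53]: **THE LAST-CUBE REDUCTION OF A CORNER SUM** — the decoupling expansion integrates the `s`-derivatives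
one cube at a time (p. 305: *"To give our expansion, we use the fundamental theorem of calculus … Here s_Γ specifies s_i = 0 for i ∉ Γ,
ds_Γ = Π_{i∈Γ} ds_i, ∂/∂s_Γ = Π_{i∈Γ} ∂/∂s_i"*, (5.13.3)); isolating ONE cube `n` of `Γ` turns the corner sum
(the iterated difference over `{0,1}^Γ`) into a corner sum over `Γ ∖ {n}` of FIRST differences in the `n`-th coordinate, and the mean value
theorem bounds each first difference by the supremum of the `s_n`-derivative on the segment.  Consequence: `|cornerSum (g ∘ 1_·) Γ| ≤
2^{|Γ|−1} · sup_{Λ ⊆ Γ∖{n}, σ ∈ [0,1]} |∂_{s_n} g(1_Λ + σe_n)|` — the order-ONE entrance to (5.14.4) on polymers with several cubes (to be fed with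
p13's `BIJ88CumulantAllOrders5133.hasDerivAt_dexp` / `BIJ88WalkFormOrderOne5133.dexp_singleton_walk` for `g = ⟨·⟩_s`), recorded for the successor
of p36 gen 18 (HOME/HANDOFF.md p36 gen 18, HOME/GAPS.md G-C2-p36-10/11: when the cube `n` is far from the decorations, `∂_{s_n}⟨·⟩_s` is a train from
the bonds of `n` back to the decorated cubes and is small by a covariance-decay letter alone).

statement-level skeleton of published theorems with citation tags; proofs where landed; nothing here is a claim about the Yang–Mills mass gap

PDF held: `paper:balaban1988-cmp114-bij-abelian-higgs-effective-action` (journal page = PDF page + 256); p. 305 (text layer p0049.txt L19–23),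
verbatim: *"To give our expansion, we use the fundamental theorem of calculus to write [(5.13.3)]. Here s_Γ specifies s_i = 0 for i ∉ Γ, ds_Γ =
Π_{i∈Γ} ds_i, ∂/∂s_Γ = Π_{i∈Γ} ∂/∂s_i and ⟨·⟩_{s_Γ} is the expectation with quadratic form Δ_{s_Γ} instead of Δ."*; p. 307 (p0051.txt L3–5),
verbatim: *"Each time some □_i's are joined, we have s-derivatives, which produce functional derivatives, chains of covariances C_ω(α), and
factors ℱ = O(e^{−cr(e_k)})."*

(v1.1 DOC-ONLY: the p. 307 quotation re-read on the x2 render — *"□_i's"* and *"factors ℱ = O(e^{−cr(e_k)})"* (script ℱ), correcting the text layer's «□_j's» / «δF»; owner r16 g23 zero-weight docfix; declarations byte-identical to v1 p351994.)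

WHAT IS PROVED (unit `lit-balaban-p36`, generation 18 of the Phase-2 proof seat p36; SKELETON rows C2.Eq5.13.3-5.13.4 / C2.Eq5.14.3-5.14.4 of
`HOME/lit-balaban-r16/ROWS-C2-part2.md`, owner r16 — elementary identities, no (5.14.4) estimate, no head change).
* `cornerSum_eq_cornerSum_erase_sub` — `cornerSum F Γ = cornerSum (Λ ↦ F(Λ ∪ {n}) − F Λ) (Γ ∖ {n})` for `n ∈ Γ`.
* `abs_cornerSum_le_two_pow_mul` — `|cornerSum F Γ| ≤ 2^{|Γ|}·B` when `|F Λ| ≤ B` on `Λ ⊆ Γ`.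
* `corner_insert_eq_update`, `corner_eq_update_zero` — `1_{Λ∪{n}} = 1_Λ[n ↦ 1]`, `1_Λ = 1_Λ[n ↦ 0]` (`n ∉ Λ`).
* `abs_sub_le_of_hasDerivWithinAt_unit` — `|φ 1 − φ 0| ≤ B` from `|φ′| ≤ B` on `[0,1]` (Mathlib's mean value inequality).
* **`abs_cornerSum_corner_le_of_hasDerivAt`** — the displayed consequence.
HONEST SCOPE: finite combinatorics and the one-variable mean value inequality; 0 `sorry`, 0 definitions, 0 `Prop` facts (D-0026); imports
`BIJ88PolymerRep5134` (p25: `corner`, `cornerSum`) and `Mathlib.Analysis.Calculus.MeanValue`; modifies nothing.  NOT summit progress; NOT continuum;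
NOT Clay.  Cell `lit-balaban` Phase 2, seat p36 gen 18 (owner r16, referee ref-5).
-/

noncomputable section

open Finset Function Set
open Literature.MathematicalPhysics.QuantumFieldTheory.BalabanImbrieJaffe1984to88
open BIJ88Clusters5134 (cornerSum)
open BIJ88PolymerRep5134 (corner corner_apply)

namespace Literature.MathematicalPhysics.QuantumFieldTheory.BalabanImbrieJaffe1984to88.BIJ88CornerSumLastCube309

/-! ## §1 Isolating one cube of a corner sum -/
section Combinatorics

variable {ι : Type*} [DecidableEq ι] {R : Type*} [CommRing R]

/-- **isolating one cube**: for `n ∈ Γ`, the corner sum over `Γ` is the corner sum over `Γ ∖ {n}` of the first differences in the `n`-th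
coordinate (the `s_n`-integration of (5.13.3) done last). [cite: BalabanImbrieJaffe1988, (5.13.3) p.305] -/
theorem cornerSum_eq_cornerSum_erase_sub (F : Finset ι → R) {Γ : Finset ι} {n : ι} (hn : n ∈ Γ) :
    cornerSum F Γ = cornerSum (fun Λ => F (insert n Λ) - F Λ) (Γ.erase n) := by
  have hn' : n ∉ Γ.erase n := Finset.notMem_erase n Γ
  conv_lhs => rw [← Finset.insert_erase hn]
  rw [cornerSum, cornerSum, Finset.sum_powerset_insert hn']
  have h1 : ∀ Λ ∈ (Γ.erase n).powerset,
      (-1 : R) ^ (insert n (Γ.erase n) \ Λ).card * F Λ = -((-1 : R) ^ (Γ.erase n \ Λ).card * F Λ) := by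
    intro Λ hΛ
    have hnΛ : n ∉ Λ := fun h => hn' (Finset.mem_powerset.1 hΛ h)
    have he : insert n (Γ.erase n) \ Λ = insert n (Γ.erase n \ Λ) := by
      ext x
      simp only [Finset.mem_sdiff, Finset.mem_insert]
      constructor
      · rintro ⟨h | h, hx⟩
        · exact Or.inl h
        · exact Or.inr ⟨h, hx⟩
      · rintro (h | ⟨h, hx⟩)
        · exact ⟨Or.inl h, h ▸ hnΛ⟩
        · exact ⟨Or.inr h, hx⟩
    rw [he, Finset.card_insert_of_notMem (fun h => hn' (Finset.mem_sdiff.1 h).1), pow_succ]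
    ring
  have h2 : ∀ Λ ∈ (Γ.erase n).powerset,
      (-1 : R) ^ (insert n (Γ.erase n) \ insert n Λ).card * F (insert n Λ) = (-1 : R) ^ (Γ.erase n \ Λ).card * F (insert n Λ) := by
    intro Λ hΛ
    have he : insert n (Γ.erase n) \ insert n Λ = Γ.erase n \ Λ := by
      ext x
      simp only [Finset.mem_sdiff, Finset.mem_insert, not_or]
      constructor
      · rintro ⟨h | h, hxn, hx⟩
        · exact absurd h hxn
        · exact ⟨h, hx⟩
      · rintro ⟨h, hx⟩
        exact ⟨Or.inr h, fun hxn => hn' (hxn ▸ h), hx⟩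
    rw [he]
  rw [Finset.sum_congr rfl h1, Finset.sum_congr rfl h2, Finset.sum_neg_distrib, ← sub_eq_neg_add, ← Finset.sum_sub_distrib]
  refine Finset.sum_congr rfl fun Λ _ => ?_
  ring

/-- the crude bound: `2^{|Γ|}` corners, each at most `B`. [cite: BalabanImbrieJaffe1988, (5.13.3) p.305] -/
theorem abs_cornerSum_le_two_pow_mul {F : Finset ι → ℝ} {Γ : Finset ι} {B : ℝ} (h : ∀ Λ ⊆ Γ, |F Λ| ≤ B) :
    |cornerSum F Γ| ≤ 2 ^ Γ.card * B := by
  unfold cornerSum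
  calc |∑ Λ ∈ Γ.powerset, (-1 : ℝ) ^ (Γ \ Λ).card * F Λ| ≤ ∑ Λ ∈ Γ.powerset, |(-1 : ℝ) ^ (Γ \ Λ).card * F Λ| :=
        Finset.abs_sum_le_sum_abs _ _
    _ = ∑ Λ ∈ Γ.powerset, |F Λ| := Finset.sum_congr rfl fun Λ _ => by rw [abs_mul, abs_pow, abs_neg, abs_one, one_pow, one_mul]
    _ ≤ ∑ _Λ ∈ Γ.powerset, B := Finset.sum_le_sum fun Λ hΛ => h Λ (Finset.mem_powerset.1 hΛ)
    _ = 2 ^ Γ.card * B := by rw [Finset.sum_const, Finset.card_powerset, nsmul_eq_mul]; push_cast; ring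

/-- `1_{Λ ∪ {n}} = 1_Λ[n ↦ 1]`. [cite: BalabanImbrieJaffe1988, (5.13.1) p.305] -/
theorem corner_insert_eq_update (Λ : Finset ι) (n : ι) : corner ℝ (insert n Λ) = update (corner ℝ Λ) n 1 := by
  ext i
  by_cases hi : i = n
  · subst hi; simp [corner_apply]
  · rw [update_of_ne hi, corner_apply, corner_apply]; simp [hi]

/-- `1_Λ = 1_Λ[n ↦ 0]` for `n ∉ Λ`. [cite: BalabanImbrieJaffe1988, (5.13.1) p.305] -/
theorem corner_eq_update_zero {Λ : Finset ι} {n : ι} (hn : n ∉ Λ) : corner ℝ Λ = update (corner ℝ Λ) n 0 := by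
  ext i
  by_cases hi : i = n
  · subst hi; simp [corner_apply, hn]
  · rw [update_of_ne hi]

end Combinatorics

/-! ## §2 The mean value inequality on the unit segment and the last-cube bound -/
section MeanValue

/-- `|φ(1) − φ(0)| ≤ B` when `φ` has a derivative bounded by `B` along `[0,1]` (Mathlib's `norm_image_sub_le_of_norm_deriv_le_segment_01'`).
[cite: BalabanImbrieJaffe1988, (5.13.3) p.305] -/
theorem abs_sub_le_of_hasDerivAt_unit {φ φ' : ℝ → ℝ} {B : ℝ} (hd : ∀ σ ∈ Icc (0 : ℝ) 1, HasDerivAt φ (φ' σ) σ)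
    (hb : ∀ σ ∈ Icc (0 : ℝ) 1, |φ' σ| ≤ B) : |φ 1 - φ 0| ≤ B := by
  have h := norm_image_sub_le_of_norm_deriv_le_segment_01' (fun x hx => (hd x hx).hasDerivWithinAt)
    (fun x hx => by rw [Real.norm_eq_abs]; exact hb x (Ico_subset_Icc_self hx))
  rwa [Real.norm_eq_abs] at h

variable {I : Type*} [DecidableEq I]

/-- **THE LAST-CUBE BOUND**: if along the `n`-th coordinate segment above every corner `1_Λ`, `Λ ⊆ Γ ∖ {n}`, the function `g` has a derivative
bounded by `B`, then `|cornerSum (Λ ↦ g(1_Λ)) Γ| ≤ 2^{|Γ|−1}·B` (`n ∈ Γ`).  With `g = ⟨·⟩_s` and p13's `hasDerivAt_dexp` the derivative is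
`∂{n}⟨·⟩ = dexp {n}`, a sum of trains from the bonds of the cube `n` (p13 `dexp_singleton_walk`). [cite: BalabanImbrieJaffe1988, (5.13.3) p.305; (5.14.3) p.309] -/
theorem abs_cornerSum_corner_le_of_hasDerivAt {g g' : (I → ℝ) → ℝ} {Γ : Finset I} {n : I} (hn : n ∈ Γ) {B : ℝ}
    (hd : ∀ Λ ⊆ Γ.erase n, ∀ σ ∈ Icc (0 : ℝ) 1,
      HasDerivAt (fun τ => g (update (corner ℝ Λ) n τ)) (g' (update (corner ℝ Λ) n σ)) σ)
    (hb : ∀ Λ ⊆ Γ.erase n, ∀ σ ∈ Icc (0 : ℝ) 1, |g' (update (corner ℝ Λ) n σ)| ≤ B) :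
    |cornerSum (fun Λ => g (corner ℝ Λ)) Γ| ≤ 2 ^ (Γ.card - 1) * B := by
  rw [cornerSum_eq_cornerSum_erase_sub _ hn, ← Finset.card_erase_of_mem hn]
  refine abs_cornerSum_le_two_pow_mul fun Λ hΛ => ?_
  have hnΛ : n ∉ Λ := fun h => (Finset.notMem_erase n Γ) (hΛ h)
  have h := abs_sub_le_of_hasDerivAt_unit (hd Λ hΛ) (hb Λ hΛ)
  rwa [← corner_insert_eq_update, ← corner_eq_update_zero hnΛ] at h

/-- the same bound with the derivative bound stated on the whole cube `[0,1]^I` above `Γ` — the form in which a volume-uniform letter delivers it.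
[cite: BalabanImbrieJaffe1988, (5.13.3) p.305; (5.14.3) p.309] -/
theorem abs_cornerSum_corner_le_of_hasDerivAt_of_forall {g g' : (I → ℝ) → ℝ} {Γ : Finset I} {n : I} (hn : n ∈ Γ) {B : ℝ}
    (hd : ∀ s : I → ℝ, (∀ i, 0 ≤ s i ∧ s i ≤ 1) → HasDerivAt (fun τ => g (update s n τ)) (g' s) (s n))
    (hb : ∀ s : I → ℝ, (∀ i, 0 ≤ s i ∧ s i ≤ 1) → |g' s| ≤ B) :
    |cornerSum (fun Λ => g (corner ℝ Λ)) Γ| ≤ 2 ^ (Γ.card - 1) * B := by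
  have hcube : ∀ (Λ : Finset I), ∀ σ ∈ Icc (0 : ℝ) 1, ∀ i, 0 ≤ update (corner ℝ Λ) n σ i ∧ update (corner ℝ Λ) n σ i ≤ 1 := by
    intro Λ σ hσ i
    by_cases hi : i = n
    · subst hi; simpa using hσ
    · rw [update_of_ne hi, corner_apply]; split_ifs <;> norm_num
  refine abs_cornerSum_corner_le_of_hasDerivAt hn (fun Λ _ σ hσ => ?_) (fun Λ _ σ hσ => hb _ (hcube Λ σ hσ))
  have h := hd (update (corner ℝ Λ) n σ) (hcube Λ σ hσ)
  simp only [update_idem, update_self] at h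
  exact h

end MeanValue

end Literature.MathematicalPhysics.QuantumFieldTheory.BalabanImbrieJaffe1984to88.BIJ88CornerSumLastCube309

end
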